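import Literature.Barriers.CriticalPhenomena.LaceExpansionPcSubcritLargeD
import Literature.Barriers.CriticalPhenomena.GaussianDominationRouteLemma84
import HarnessLib

/-!
# Hara's Prop. 1.2 below and at `p_c` for all sufficiently large `d`, modulo `HvdH2017_prop88` alone

Barrier catalogue `Literature/Barriers/CriticalPhenomena/` (D-0021), continuation of
`LaceExpansionPcSubcritLargeD.lean`, whose assemblies `exists_subcritBody_largeD`,
`exists_isLaceCoefficientPc_largeD` take Heydenreich–van der Hofstad's Lemma 8.4 as a hypothesis
`(h84 : HvdH2017_lemma84)`. Here that hypothesis is discharged by the tree's theorem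
`HvdH2017_lemma84_holds` (`GaussianDominationRouteLemma84.lean`): this is the first module importing
both the Gaussian-domination (Ch. 5–8) cone and the Hara `p ↑ p_c` cone (`LaceExpansionPcLimit.lean`),
made possible by the renaming of `summable_abs_conv` / `latticeFT_conv` in the latter
(`summable_abs_tsum_mul_sub` / `latticeFT_tsum_mul_sub`).

* `exists_subcritBody_largeD_of_prop88` — the body of `Hara2008_prop12Subcrit` (the subcritical
  lace expansion with `p`-uniform bounds: Hara 2008, Prop. 1.2 below `p_c` and Appendix A items
  1–2; Heydenreich–van der Hofstad, Cor. 8.13 (8.5.1)–(8.5.2)) for all `d ≥ d₀`, from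
  `HvdH2017_prop88`;
* `exists_isLaceCoefficientPc_largeD_of_prop88` — the body of `Hara2008_prop12Pc` (Prop. 1.2 AT
  `p_c`: a lace-expansion coefficient with `Ĵ(0) = 1`, the infrared lower bound, the Fourier
  representation of `τ_{p_c}` and a finite second moment) for all `d ≥ d₀`, from `HvdH2017_prop88`.

`HvdH2017_prop88` ("`f(p) ≤ 1 + const/d` uniformly in `p < p_c`, `d ≥ d₀`", Prop. 8.8) is Lemma
8.9 (`HvdH2017_lemma89_holds`) plus the improvement of the bounds, Prop. 8.10 (`HvdH2017_prop810`,
open in the tree): `HvdH2017_prop88_of_lemma89_prop810`.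

## References

* M. Heydenreich, R. van der Hofstad, *Progress in High-Dimensional Percolation and Random
  Graphs*, Springer 2017: Lemma 8.4, Lemma 8.5, Prop. 8.8, Cor. 8.13.
* T. Hara, Ann. Probab. 36 (2008) 530–593: Prop. 1.2 and Appendix A.
-/

noncomputable section

namespace Literature.Barriers.CriticalPhenomena

open Literature.Probability.LatticeModels Literature.Probability.Percolation

/-- **The body of `Hara2008_prop12Subcrit` for all sufficiently large `d`, from `HvdH2017_prop88`**
(`exists_subcritBody_largeD` with Lemma 8.4 discharged by `HvdH2017_lemma84_holds`).
[cite: HeydenreichVanDerHofstad2017, Lemma 8.4, Lemma 8.5, Prop. 8.8 and Cor. 8.13 ((8.5.1)–(8.5.2) and its proof)]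
[cite: Hara2008, Prop. 1.2 ((1.16)–(1.17)) and Appendix A (items 1–2)] -/
theorem exists_subcritBody_largeD_of_prop88 (h88 : HvdH2017_prop88) :
    ∃ d₀ : ℕ, ∀ d : ℕ, d₀ ≤ d →
      ∃ (Φ : unitInterval → Site d → ℝ) (h : Site d → ℝ) (c₁ C : ℝ) (p₀ : unitInterval),
        Summable h ∧ 0 < c₁ ∧ p₀ < criticalProbI d ∧
        (∀ p : unitInterval, p < criticalProbI d →
          IsLaceCoefficientAt d p (Φ p) ∧
          (∀ x : Site d, |Φ p x| ≤ h x) ∧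
          (Summable fun x : Site d => euclidNorm x ^ 2 * |Φ p x|) ∧
          (∑' x : Site d, euclidNorm x ^ 2 * |Φ p x|) ≤ C) ∧
        (∀ p : unitInterval, p₀ ≤ p → p < criticalProbI d →
          ∀ k ∈ cube d, c₁ * (∑ i, k i ^ 2) / d ≤
            (∑' y, laceKernel p (Φ p) y) - (latticeFT (laceKernel p (Φ p)) k).re) :=
  exists_subcritBody_largeD HvdH2017_lemma84_holds h88

/-- **Hara's Prop. 1.2 at `p = p_c` for all sufficiently large `d`, from `HvdH2017_prop88`** — the
body of `Hara2008_prop12Pc` (`exists_isLaceCoefficientPc_largeD` with Lemma 8.4 discharged by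
`HvdH2017_lemma84_holds`). [cite: Hara2008, Prop. 1.2 and Appendix A (items 1–4)]
[cite: HeydenreichVanDerHofstad2017, Cor. 8.13 and Prop. 8.8] -/
theorem exists_isLaceCoefficientPc_largeD_of_prop88 (h88 : HvdH2017_prop88) :
    ∃ d₀ : ℕ, ∀ d : ℕ, d₀ ≤ d →
      ∃ Ψ : Site d → ℝ, IsLaceCoefficientPc d Ψ ∧ Summable fun x => euclidNorm x ^ 2 * |Ψ x| :=
  exists_isLaceCoefficientPc_largeD HvdH2017_lemma84_holds h88

end Literature.Barriers.CriticalPhenomena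

end
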